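import Mathlib
import Literature.Analysis.SpecialFunctions.PowerLogMoments
import Literature.NumberTheory.Transcendental.PeriodsWave0
import HarnessLib

/-!
# Logarithmic moments on `(0,1)`: `∫₀¹ uʲ(−log u)ᵖ du = p!/(j+1)^{p+1}`, `∫₀¹ log²u/(1−u) du = 2ζ(3)`, and linearity
# combinators for `IntegrableOn ∧ value` pairs (cell `pub-zeta5`, seat ct-1 g21; item (3), inputs of the last step)

HONEST FRAMING: systematic search; no irrationality claim unless certified.  Elementary real analysis only: the pure
logarithmic inputs of the last integration of gen-1 g17's evaluation of the one-top datum `D2` (`LEVEL1-EXACT.md` Thm E),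
in the `IntegrableOn f (Ioo 0 1) ∧ ∫_{(0,1)} f = v` format of `EulerKernelBasisIntegrals`, plus the two trivial
combinators (`pair_add`, `pair_smul`) used to assemble a long linear combination of such pairs.  Theorems only; nothing here
mentions the cellular integrals; `ζ(3) = zetaValue 3` enters as `Σ 2/(n+1)³ = ∫₀¹ log²u/(1−u) du`.
-/

noncomputable section

open MeasureTheory Set Filter Topology intervalIntegral
open scoped ENNReal Nat

namespace Summit.KontsevichZagierPeriods.Zeta5Search.EulerKernel

open Literature.NumberTheory.Transcendental (zetaValue)

/-! ## 1. Linearity combinators for `IntegrableOn ∧ value` pairs -/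

/-- Sum of two `IntegrableOn ∧ value` pairs. [folklore] -/
theorem pair_add {s : Set ℝ} {f g : ℝ → ℝ} {a b : ℝ}
    (hf : IntegrableOn f s ∧ ∫ x in s, f x = a) (hg : IntegrableOn g s ∧ ∫ x in s, g x = b) :
    IntegrableOn (fun x => f x + g x) s ∧ ∫ x in s, (f x + g x) = a + b := by
  refine ⟨hf.1.add hg.1, ?_⟩
  rw [integral_add hf.1 hg.1, hf.2, hg.2]

/-- Scalar multiple of an `IntegrableOn ∧ value` pair. [folklore] -/
theorem pair_smul {s : Set ℝ} {f : ℝ → ℝ} {a : ℝ} (c : ℝ)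
    (hf : IntegrableOn f s ∧ ∫ x in s, f x = a) :
    IntegrableOn (fun x => c * f x) s ∧ ∫ x in s, c * f x = c * a := by
  refine ⟨hf.1.const_mul c, ?_⟩
  rw [MeasureTheory.integral_const_mul, hf.2]

/-- Transport of an `IntegrableOn ∧ value` pair along an a.e.-equality on a measurable set. [folklore] -/
theorem pair_congr {s : Set ℝ} (hs : MeasurableSet s) {f g : ℝ → ℝ} {a : ℝ}
    (hf : IntegrableOn f s ∧ ∫ x in s, f x = a) (hfg : ∀ x ∈ s, g x = f x) :
    IntegrableOn g s ∧ ∫ x in s, g x = a := by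
  refine ⟨hf.1.congr_fun (fun x hx => (hfg x hx).symm) hs, ?_⟩
  rw [setIntegral_congr_fun hs hfg, hf.2]

/-! ## 2. The moments `∫₀¹ uʲ (−log u)ᵖ du = p!/(j+1)^{p+1}` (real form) -/

/-- `∫₀¹ uʲ(−log u)ᵖ du = p!/(j+1)^{p+1}` with integrability on `(0,1)` (Gradshteyn–Ryzhik 4.272 6; the tree's
`integral_rpow_mul_log_pow_zero_one`). [folklore] -/
theorem integral_pow_mul_negLog_pow (j p : ℕ) :
    IntegrableOn (fun u : ℝ => u ^ j * (-Real.log u) ^ p) (Ioo 0 1) ∧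
      ∫ u in Ioo (0:ℝ) 1, u ^ j * (-Real.log u) ^ p = (p ! : ℝ) / ((j : ℝ) + 1) ^ (p + 1) := by
  have hs : (-1 : ℝ) < (j : ℝ) := by linarith [(Nat.cast_nonneg j : (0 : ℝ) ≤ j)]
  have hint : IntervalIntegrable (fun u : ℝ => u ^ (j : ℝ) * Real.log u ^ p) volume 0 1 :=
    Literature.Analysis.SpecialFunctions.intervalIntegrable_rpow_mul_log_pow hs p zero_le_one
  have hval : ∫ u in (0:ℝ)..1, u ^ (j : ℝ) * Real.log u ^ p = (-1) ^ p * (p ! : ℝ) / ((j : ℝ) + 1) ^ (p + 1) :=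
    Literature.Analysis.SpecialFunctions.integral_rpow_mul_log_pow_zero_one hs p
  have hfun : ∀ u ∈ Ioo (0:ℝ) 1, u ^ j * (-Real.log u) ^ p = (-1) ^ p * (u ^ (j : ℝ) * Real.log u ^ p) := by
    intro u hu
    rw [Real.rpow_natCast, neg_pow]
    ring
  have hI : IntegrableOn (fun u : ℝ => (-1 : ℝ) ^ p * (u ^ (j : ℝ) * Real.log u ^ p)) (Ioo 0 1) := by
    have h2 := hint.const_mul ((-1 : ℝ) ^ p)
    rw [intervalIntegrable_iff_integrableOn_Ioo_of_le zero_le_one] at h2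
    exact h2
  refine pair_congr measurableSet_Ioo ⟨hI, ?_⟩ hfun
  rw [MeasureTheory.integral_const_mul, ← integral_Ioc_eq_integral_Ioo, ← intervalIntegral.integral_of_le zero_le_one,
    hval, show (-1 : ℝ) ^ p * ((-1) ^ p * (p ! : ℝ) / ((j : ℝ) + 1) ^ (p + 1)) =
      ((-1 : ℝ) ^ p * (-1) ^ p) * (p ! : ℝ) / ((j : ℝ) + 1) ^ (p + 1) by ring, ← mul_pow]
  norm_num

/-! ## 3. `∫₀¹ log²u/(1 − u) du = 2ζ(3)` -/

/-- `∫⁻_{(0,1)} uⁿ ℓ² = ofReal (2/(n+1)³)` (`ℝ≥0∞` form of the moment). [folklore] -/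
theorem lintegral_pow_mul_negLog_sq (n : ℕ) :
    ∫⁻ u in Ioo (0:ℝ) 1, ENNReal.ofReal (u ^ n * (-Real.log u) ^ 2) = ENNReal.ofReal (2 / ((n : ℝ) + 1) ^ 3) := by
  obtain ⟨hI, hv⟩ := integral_pow_mul_negLog_pow n 2
  have hnn : 0 ≤ᵐ[volume.restrict (Ioo (0:ℝ) 1)] fun u : ℝ => u ^ n * (-Real.log u) ^ 2 :=
    (ae_restrict_mem measurableSet_Ioo).mono fun u hu => by have := hu.1.le; positivity
  rw [← ofReal_integral_eq_lintegral_ofReal hI hnn, hv]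
  norm_num [Nat.factorial]

/-- **`∫₀¹ log²u/(1−u) du = 2ζ(3)`**, with integrability: expand `1/(1−u) = Σ uⁿ` (all terms `≥ 0`), integrate
termwise (`lintegral_tsum`), `Σ 2/(n+1)³ = 2ζ(3)`. [folklore] -/
theorem integral_negLog_sq_div_one_sub :
    IntegrableOn (fun u : ℝ => (-Real.log u) ^ 2 / (1 - u)) (Ioo 0 1) ∧
      ∫ u in Ioo (0:ℝ) 1, (-Real.log u) ^ 2 / (1 - u) = 2 * zetaValue 3 := by
  -- pointwise series in `ℝ≥0∞`
  have hpt : ∀ u ∈ Ioo (0:ℝ) 1, ENNReal.ofReal ((-Real.log u) ^ 2 / (1 - u)) =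
      ∑' n : ℕ, ENNReal.ofReal (u ^ n * (-Real.log u) ^ 2) := by
    intro u hu
    have hg : HasSum (fun n : ℕ => u ^ n) (1 - u)⁻¹ :=
      hasSum_geometric_of_lt_one hu.1.le hu.2
    have hg' : HasSum (fun n : ℕ => u ^ n * (-Real.log u) ^ 2) ((1 - u)⁻¹ * (-Real.log u) ^ 2) := hg.mul_right _
    rw [show (-Real.log u) ^ 2 / (1 - u) = (1 - u)⁻¹ * (-Real.log u) ^ 2 by rw [div_eq_inv_mul], ← hg'.tsum_eq,
      ENNReal.ofReal_tsum_of_nonneg (fun n => by have := hu.1.le; positivity) hg'.summable]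
  have hL : ∫⁻ u in Ioo (0:ℝ) 1, ENNReal.ofReal ((-Real.log u) ^ 2 / (1 - u)) = ENNReal.ofReal (2 * zetaValue 3) := by
    rw [setLIntegral_congr_fun measurableSet_Ioo hpt, lintegral_tsum (fun n => by apply Measurable.aemeasurable; fun_prop)]
    simp_rw [lintegral_pow_mul_negLog_sq]
    have hz : HasSum (fun n : ℕ => 2 / ((n : ℝ) + 1) ^ 3) (2 * zetaValue 3) := by
      have hs : Summable (fun n : ℕ => 1 / (n : ℝ) ^ 3) := Real.summable_one_div_nat_pow.mpr (by norm_num)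
      have h := (hasSum_nat_add_iff' (f := fun n : ℕ => 1 / (n : ℝ) ^ 3) 1).mpr hs.hasSum
      simp only [Finset.range_one, Finset.sum_singleton, Nat.cast_zero, ne_eq, OfNat.ofNat_ne_zero,
        not_false_eq_true, zero_pow, div_zero, sub_zero, Nat.cast_add, Nat.cast_one] at h
      have h2 := h.mul_left 2
      refine (show HasSum (fun n : ℕ => 2 * (1 / ((n : ℝ) + 1) ^ 3)) (2 * zetaValue 3) from h2).congr_fun fun n => ?_
      ring
    rw [← ENNReal.ofReal_tsum_of_nonneg (fun n => by positivity) hz.summable, hz.tsum_eq]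
  have hnn : 0 ≤ᵐ[volume.restrict (Ioo (0:ℝ) 1)] fun u : ℝ => (-Real.log u) ^ 2 / (1 - u) :=
    (ae_restrict_mem measurableSet_Ioo).mono fun u hu => by
      have : 0 ≤ 1 - u := by linarith [hu.2]
      positivity
  have hmeas : AEStronglyMeasurable (fun u : ℝ => (-Real.log u) ^ 2 / (1 - u)) (volume.restrict (Ioo (0:ℝ) 1)) :=
    (Measurable.aestronglyMeasurable (by fun_prop))
  have h0 : 0 ≤ 2 * zetaValue 3 := by
    have : 0 ≤ zetaValue 3 := tsum_nonneg fun n => by positivity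
    positivity
  refine ⟨⟨hmeas, ?_⟩, ?_⟩
  · rw [hasFiniteIntegral_iff_ofReal hnn, hL]; exact ENNReal.ofReal_lt_top
  · rw [integral_eq_lintegral_of_nonneg_ae hnn hmeas, hL, ENNReal.toReal_ofReal h0]

end Summit.KontsevichZagierPeriods.Zeta5Search.EulerKernel
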